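import Mathlib
import Summits.CriticalPhenomena.PercolationContinuityZ3.Theorems.PercNearOneGluingNoHeavyLowerTailObserverUnionBound
import Summits.CriticalPhenomena.PercolationContinuityZ3.Theorems.PercNearOneGluingNoHeavyLowerTailSpiderCIL
import Literature.Probability.Percolation.KozmaNitzanPinning
import Literature.Probability.LatticeModels.ProdBernoulliCoupling
import HarnessLib

/-!
# `NoHeavyLowerTail` (stmt-CriticalPhenomena-4575) — the first-edge union bound in `G ∖ e`-FORM, and SPIDERS with the
# relay lightness measured IN `G` (not in `G − o`)

Seat `prim-cplus-engine` gen 7, 2026-08-19 (`--supports stmt-CriticalPhenomena-4575`).  No definitions, no named facts,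
no sorries.  Companion of `…ObserverUnionBound.lean` (lead gen 6, p192231) and `…SpiderCIL.lean` (p192370).

Finite weighted graph on `Fin n` (`μ_w = prodBernoulli w`), relay set `A`, observer `o ∉ A`, `N_o = |C(o) ∩ A|`.
For a pair `e` write `G ∖ e` for the SAME graph with the single pair `e` closed, i.e. the weights
`pinW w {e} ∅` (`KozmaNitzanPinning.lean`); `μ_{G∖e}(E) = μ_w(E | e closed)` for every event `E`.

* `lowerTail_subset_biUnion_firstEdge_erase` — event inclusion: `{1 ≤ N_o ≤ j} ⊆ ⋃_{x ≠ o} ({s(o,x) open} ∩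
  {1 ≤ N_x(ω ∖ s(o,x)) ≤ j})`: cut an open path `o → a` at its first edge `s(o,x)`; the rest avoids `o`, hence avoids
  the pair `s(o,x)`, so `N_x(ω ∖ s(o,x)) ≥ 1`; and every relay joined to `x` in `ω ∖ s(o,x)` is joined to `x` in `ω`,
  hence to `o` (the pair `s(o,x)` is open), so `N_x(ω ∖ s(o,x)) ≤ N_o ≤ j`.
* `lowerTail_le_sum_firstEdge_pinW` — **the union bound in `G ∖ e`-form**:
      `μ_w(1 ≤ N_o ≤ j) ≤ Σ_{x ≠ o} w(o,x) · μ_{G ∖ s(o,x)}(1 ≤ N_x ≤ j)`.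
  Compare the `H`-form `…ObserverUnionBound.lowerTail_le_sum_firstEdge_restrW` (reference graph `G − o`, ALL pairs at
  `o` closed): here only the one pair back to `o` is closed, `o` and its other pairs stay in the reference graph of
  every neighbour.  This is the point: the reliability hypotheses of the crux are stated in `G`, and
* `pinW_single_real_mul_le` — **closing one pair of weight `w(e)` costs at most the factor `1/(1 − w(e))`**:
  `(1 − w(e)) · μ_{G∖e}(E) ≤ μ_w(E)` for EVERY event `E` (it is `μ_w(E ∩ {e closed})`), whereas deleting the
  vertex `o` has no such price list (the hub obstruction of LEAD-GEN6 §8b);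
* `pinW_single_light_le_restrW_light` — and the `G ∖ s(o,x)`-lightness of a relay never exceeds its `G − o`-lightness
  (`{|π(a)| ≤ j}` is a decreasing event and `restrW {o}ᶜ w ≤ pinW w {s(o,x)} ∅`), so the bound here dominates the
  `H`-form one term by term.
* `spider_lowerTail_le_pinW`, `spider_lowerTail_le_G`, `spider_smallBlock_le_G` — SPIDERS (every non-relay neighbour
  of `o` starts a Steiner path with relay hairs whose only other non-relay contact is `o` at its start; legs of any
  length; `o` may carry direct relay edges; relay side arbitrary):
      `μ_w(1 ≤ N_o ≤ j) ≤ (Σ_{x ≠ o} w(o,x)) · M`        whenever `μ_{G∖s(o,x)}(|π(a)| ≤ j) ≤ M` for all `x ≠ o`, `a ∈ A`;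
      `μ_w(1 ≤ N_o ≤ j) ≤ (Σ_{x ≠ o} w(o,x)) · 2M`       whenever `μ_w(|π(a)| ≤ j) ≤ M` on `A` and `w(o,x) ≤ 1/2` off `A`;
      `μ_w(1 ≤ N_o, 2N_o ≤ |A|) ≤ (Σ_{x ≠ o} w(o,x)) · 8η` whenever `μ_w(a ↮ a') ≤ η` on `A` (IN `G`) and `w(o,x) ≤ 1/2`.
  The last two are `G`-FORM: the hypotheses are the crux's own (`P_G(a ↮ a′) ≤ t`), with no square-root conversion;
  uniform in the leg lengths and `|A|`, linear in the number of legs (via `Σ w(o,x)`).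

READING (for LEAD-GEN6 §8b).  One-step peeling does NOT force the reference graph `G − o`: peeling ONE open edge at a
time (union bound) keeps `o` in the reference graph of the peeled neighbour, at the price `1/(1 − w(o,x))` per peeled
pair.  Iterating along depth accumulates these prices along the peeled trail (`∏ 1/(1 − w)`), so this is a one-layer
tool, not a depth engine; for spiders one layer is all that is needed because the legs are Steiner paths, for which
`cil_steinerPath` is already `G`-form and length-uniform.
-/

namespace Summit.CriticalPhenomena.PercolationContinuityZ3.Theorems

open MeasureTheory Set
open Literature.Probability.LatticeModels (prodBernoulli prodBernoulli_real_setOf_mem prodBernoulli_real_setOf_notMem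
  prodBernoulli_real_inter_of_determinedBy prodBernoulli_real_eq_of_determinedBy prodBernoulli_real_mono_of_isUpperSet)
open Literature.Probability.Percolation

noncomputable section
open Classical

variable {n : ℕ}

namespace ObserverUnionBoundG

/-! ### Configurations with one pair removed -/

/-- Removing a pair only removes open edges: `ω ∖ {e} ⊆ ω`. [folklore] -/
theorem diff_singleton_subset (ω : BondConfig (Fin n)) (e : Sym2 (Fin n)) : ω \ {e} ⊆ ω :=
  fun _ h => h.1

/-- An open path avoiding the vertex `o` survives the removal of any pair at `o`:
`{x ↔ a off o} ⊆ {x ↔ a in ω ∖ s(o,u)}` for `x ≠ o`. [this work] -/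
theorem diff_mem_openConn_of_openConnIn {ω : BondConfig (Fin n)} {o x a : Fin n} (u : Fin n) (hxo : x ≠ o)
    (h : ω ∈ openConnIn ({o}ᶜ : Set (Fin n)) x a) : ω \ {s(o, u)} ∈ openConn x a := by
  have h1 : ω ∩ wireSet ({o}ᶜ : Set (Fin n)) ∈ (openConn x a : Set (BondConfig (Fin n))) :=
    (KNGoodAux.inter_wireSet_mem_openConn_iff (mem_compl_singleton_iff.2 hxo) a).2 h
  refine isUpperSet_openConn x a ?_ h1
  intro e he
  refine ⟨he.1, fun heu => ?_⟩
  rw [mem_singleton_iff] at heu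
  subst heu
  have := (mk_mem_wireSet_iff.1 he.2).1
  exact this rfl

/-- The event "`ω ∖ {e}` lies in `E`" reads only the pairs other than `e`. [folklore] -/
theorem determinedBy_preimage_diff (E : Set (BondConfig (Fin n))) (e : Sym2 (Fin n)) :
    DeterminedBy {ω : BondConfig (Fin n) | ω \ {e} ∈ E} ({e}ᶜ : Set (Sym2 (Fin n))) := by
  rw [determinedBy_iff]
  intro ω ω' h
  have : ω \ {e} = ω' \ {e} := by
    ext i
    have hi := Set.ext_iff.1 h i
    simp only [mem_inter_iff, mem_compl_iff, mem_sdiff] at hi ⊢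
    exact hi
  simp only [mem_setOf_eq, this]

/-- **Independence of the pair `e` from the configuration off `e`**:
`μ_w({e open} ∩ {ω ∖ e ∈ E}) = w(e) · μ_w(ω ∖ e ∈ E)`. [folklore] -/
theorem real_mem_inter_preimage_diff (w : Sym2 (Fin n) → unitInterval) (E : Set (BondConfig (Fin n)))
    (e : Sym2 (Fin n)) :
    (prodBernoulli w).real ({ω : BondConfig (Fin n) | e ∈ ω} ∩ {ω : BondConfig (Fin n) | ω \ {e} ∈ E}) =
      (w e : ℝ) * (prodBernoulli w).real {ω : BondConfig (Fin n) | ω \ {e} ∈ E} := by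
  set F : Finset (Sym2 (Fin n)) := {e} with hF
  have hA : DeterminedBy {ω : BondConfig (Fin n) | e ∈ ω} (↑F : Set (Sym2 (Fin n))) := by
    rw [determinedBy_iff]
    intro ω ω' hωω'
    have := Set.ext_iff.1 hωω' e
    simp only [hF, Finset.coe_singleton, mem_inter_iff, mem_singleton_iff, and_true] at this
    simp only [mem_setOf_eq, this]
  have hB : DeterminedBy {ω : BondConfig (Fin n) | ω \ {e} ∈ E} (↑F : Set (Sym2 (Fin n)))ᶜ := by
    rw [hF, Finset.coe_singleton]
    exact determinedBy_preimage_diff E e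
  rw [prodBernoulli_real_inter_of_determinedBy w F hA hB MeasurableSet.of_discrete MeasurableSet.of_discrete,
    prodBernoulli_real_setOf_mem]

/-- **The law of `ω ∖ e` under `μ_w` is `μ_{G∖e}`**: `μ_w(ω ∖ e ∈ E) = μ_{pinW w {e} ∅}(E)`. [folklore] -/
theorem real_preimage_diff_eq_pinW (w : Sym2 (Fin n) → unitInterval) (E : Set (BondConfig (Fin n)))
    (e : Sym2 (Fin n)) :
    (prodBernoulli w).real {ω : BondConfig (Fin n) | ω \ {e} ∈ E} =
      (prodBernoulli (pinW w ({e} : Set (Sym2 (Fin n))) ∅)).real E := by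
  set w' := pinW w ({e} : Set (Sym2 (Fin n))) ∅ with hw'
  -- the two weightings agree off `e`, and the event reads only pairs off `e`
  have h1 : (prodBernoulli w).real {ω : BondConfig (Fin n) | ω \ {e} ∈ E} =
      (prodBernoulli w').real {ω : BondConfig (Fin n) | ω \ {e} ∈ E} :=
    prodBernoulli_real_eq_of_determinedBy w w' (F := ({e} : Set (Sym2 (Fin n)))ᶜ)
      (fun i hi => (pinW_apply_of_not_mem w ∅ (fun h => hi h)).symm)
      (determinedBy_preimage_diff E e) MeasurableSet.of_discrete
  rw [h1]
  -- under `μ_{G∖e}` the pair `e` is almost surely closed, so `ω ∖ e = ω`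
  refine measureReal_congr ?_
  filter_upwards [prodBernoulli_pinW_ae_localCylinder w (Set.countable_singleton e) (∅ : Set (Sym2 (Fin n)))]
    with ω hω
  have he : e ∉ ω := fun h => by simpa using (hω e (mem_singleton e)).1 h
  have : ω \ {e} = ω := Set.sdiff_singleton_eq_self he
  exact congrArg (· ∈ E) this

/-- **Price of closing one pair**: `(1 − w(e)) · μ_{G∖e}(E) ≤ μ_w(E)` for every event `E`
(`μ_w(E ∩ {e closed}) = μ_w(e closed) · μ_{pinW w {e} ∅}(E)`, `KozmaNitzanPinning`). [folklore] -/
theorem pinW_single_real_mul_le (w : Sym2 (Fin n) → unitInterval) (E : Set (BondConfig (Fin n)))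
    (e : Sym2 (Fin n)) :
    (1 - (w e : ℝ)) * (prodBernoulli (pinW w ({e} : Set (Sym2 (Fin n))) ∅)).real E ≤
      (prodBernoulli w).real E := by
  have key := prodBernoulli_real_inter_localCylinder w ({e} : Finset (Sym2 (Fin n))) (∅ : Set (Sym2 (Fin n)))
    (A := E) MeasurableSet.of_discrete
  rw [Finset.coe_singleton] at key
  have hcyl : localCylinder ({e} : Set (Sym2 (Fin n))) (∅ : Set (Sym2 (Fin n))) =
      {ω : BondConfig (Fin n) | e ∉ ω} := by
    ext ω
    simp only [localCylinder, mem_singleton_iff, forall_eq, mem_empty_iff_false, iff_false, mem_setOf_eq]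
  rw [hcyl, prodBernoulli_real_setOf_notMem] at key
  rw [← key]
  exact measureReal_mono Set.inter_subset_left (measure_ne_top _ _)

/-- Pointwise, deleting the vertex `o` closes at least the pair `s(o,x)`: `restrW {o}ᶜ w ≤ pinW w {s(o,x)} ∅`. [folklore] -/
theorem restrW_le_pinW_single (w : Sym2 (Fin n) → unitInterval) (o x : Fin n) :
    restrW ({o}ᶜ : Set (Fin n)) w ≤ pinW w ({s(o, x)} : Set (Sym2 (Fin n))) ∅ := by
  intro e
  by_cases he : e ∈ ({s(o, x)} : Set (Sym2 (Fin n)))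
  · rw [mem_singleton_iff] at he
    subst he
    have : s(o, x) ∉ wireSet ({o}ᶜ : Set (Fin n)) := fun h => (mk_mem_wireSet_iff.1 h).1 rfl
    rw [restrW_apply_of_not_mem w this]
    exact bot_le
  · rw [pinW_apply_of_not_mem w ∅ he]
    exact restrW_le _ w e

/-- **`G ∖ s(o,x)`-lightness is at most `G − o`-lightness**: for a relay `a`,
`μ_{pinW w {s(o,x)} ∅}(|π(a)| ≤ j) ≤ μ_{restrW {o}ᶜ w}(|π(a)| ≤ j)` — the event is decreasing and
`restrW {o}ᶜ w ≤ pinW w {s(o,x)} ∅`.  So every bound of this file dominates its `H`-form twin. [this work] -/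
theorem pinW_single_light_le_restrW_light (w : Sym2 (Fin n) → unitInterval) (A : Finset (Fin n))
    (o x a : Fin n) (j : ℕ) :
    (prodBernoulli (pinW w ({s(o, x)} : Set (Sym2 (Fin n))) ∅)).real
        {ω : BondConfig (Fin n) | (A.filter fun z => ω ∈ openConn a z).card ≤ j} ≤
      (prodBernoulli (restrW ({o}ᶜ : Set (Fin n)) w)).real
        {ω : BondConfig (Fin n) | (A.filter fun z => ω ∈ openConn a z).card ≤ j} := by
  set L : Set (BondConfig (Fin n)) := {ω | (A.filter fun z => ω ∈ openConn a z).card ≤ j} with hL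
  -- the complement `{j < |π(a)|}` is increasing
  have hup : IsUpperSet Lᶜ := by
    intro ω ω' hle hω
    simp only [hL, mem_compl_iff, mem_setOf_eq, not_le] at hω ⊢
    refine lt_of_lt_of_le hω (Finset.card_le_card fun z hz => ?_)
    rw [Finset.mem_filter] at hz ⊢
    exact ⟨hz.1, isUpperSet_openConn a z hle hz.2⟩
  have hmono := prodBernoulli_real_mono_of_isUpperSet (restrW_le_pinW_single w o x) hup MeasurableSet.of_discrete
  rw [probReal_compl_eq_one_sub MeasurableSet.of_discrete, probReal_compl_eq_one_sub MeasurableSet.of_discrete]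
    at hmono
  linarith

/-! ### The first-edge union bound in `G ∖ e`-form -/

/-- **Event inclusion.**  For `o ∉ A`:
`{1 ≤ N_o ≤ j} ⊆ ⋃_{x ≠ o} ({s(o,x) open} ∩ {1 ≤ N_x(ω ∖ s(o,x)) ≤ j})`. [this work] -/
theorem lowerTail_subset_biUnion_firstEdge_erase (A : Finset (Fin n)) (o : Fin n) (ho : o ∉ A) (j : ℕ) :
    {ω : BondConfig (Fin n) | 1 ≤ (A.filter fun a => ω ∈ openConn o a).card ∧ (A.filter fun a => ω ∈ openConn o a).card ≤ j} ⊆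
      ⋃ x ∈ (Finset.univ.filter fun x : Fin n => x ≠ o),
        ({ω : BondConfig (Fin n) | s(o, x) ∈ ω} ∩
          {ω : BondConfig (Fin n) | ω \ {s(o, x)} ∈
            {ω' : BondConfig (Fin n) | 1 ≤ (A.filter fun a => ω' ∈ openConn x a).card ∧ (A.filter fun a => ω' ∈ openConn x a).card ≤ j}}) := by
  intro ω hω
  obtain ⟨h1, hj⟩ := hω
  obtain ⟨a, ha⟩ := Finset.card_pos.1 h1
  rw [Finset.mem_filter] at ha
  obtain ⟨haA, hoa⟩ := ha
  have hao : a ≠ o := fun h => ho (h ▸ haA)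
  obtain ⟨p⟩ := (hoa : (openGraph ω).Reachable o a)
  obtain ⟨x, hxB, hxo, hxa⟩ := (KNPreFKG.walk_decomp (ObserverUnionBound.mem_starEvent_self o ω) p hao).2 rfl
  have hxB' : s(o, x) ∈ ω := hxB
  rw [Set.mem_iUnion₂]
  refine ⟨x, Finset.mem_filter.2 ⟨Finset.mem_univ _, hxo⟩, hxB', ?_⟩
  -- relays joined to `x` in `ω ∖ s(o,x)` are joined to `o` in `ω`
  have hsub : (A.filter fun a' => ω \ {s(o, x)} ∈ openConn x a') ⊆ (A.filter fun a' => ω ∈ openConn o a') := by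
    intro a' ha'
    rw [Finset.mem_filter] at ha' ⊢
    refine ⟨ha'.1, ?_⟩
    have hxa' : ω ∈ openConn x a' := isUpperSet_openConn x a' (diff_singleton_subset ω _) ha'.2
    have hadj : (openGraph ω).Adj o x := (openGraph_adj ω o x).2 ⟨hxB', hxo.symm⟩
    exact hadj.reachable.trans hxa'
  refine ⟨Finset.card_pos.2 ⟨a, Finset.mem_filter.2 ⟨haA, diff_mem_openConn_of_openConnIn x hxo hxa⟩⟩, ?_⟩
  exact (Finset.card_le_card hsub).trans hj

/-- **The first-edge union bound, `G ∖ e`-form.**  For `o ∉ A` and every level `j`: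
`μ_w(1 ≤ N_o ≤ j) ≤ Σ_{x ≠ o} w(o,x) · μ_{pinW w {s(o,x)} ∅}(1 ≤ N_x ≤ j)` — in the `x`-term only the pair `s(o,x)`
is closed; `o` and all its other pairs remain in the reference graph. [this work] -/
theorem lowerTail_le_sum_firstEdge_pinW (w : Sym2 (Fin n) → unitInterval) (A : Finset (Fin n)) (o : Fin n)
    (ho : o ∉ A) (j : ℕ) :
    (prodBernoulli w).real {ω : BondConfig (Fin n) | 1 ≤ (A.filter fun a => ω ∈ openConn o a).card ∧ (A.filter fun a => ω ∈ openConn o a).card ≤ j} ≤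
      ∑ x ∈ (Finset.univ.filter fun x : Fin n => x ≠ o),
        (w s(o, x) : ℝ) * (prodBernoulli (pinW w ({s(o, x)} : Set (Sym2 (Fin n))) ∅)).real
          {ω : BondConfig (Fin n) | 1 ≤ (A.filter fun a => ω ∈ openConn x a).card ∧ (A.filter fun a => ω ∈ openConn x a).card ≤ j} := by
  calc (prodBernoulli w).real {ω : BondConfig (Fin n) | 1 ≤ (A.filter fun a => ω ∈ openConn o a).card ∧ (A.filter fun a => ω ∈ openConn o a).card ≤ j}
      ≤ (prodBernoulli w).real (⋃ x ∈ (Finset.univ.filter fun x : Fin n => x ≠ o),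
          ({ω : BondConfig (Fin n) | s(o, x) ∈ ω} ∩
            {ω : BondConfig (Fin n) | ω \ {s(o, x)} ∈
              {ω' : BondConfig (Fin n) | 1 ≤ (A.filter fun a => ω' ∈ openConn x a).card ∧ (A.filter fun a => ω' ∈ openConn x a).card ≤ j}})) :=
        measureReal_mono (lowerTail_subset_biUnion_firstEdge_erase A o ho j) (measure_ne_top _ _)
    _ ≤ ∑ x ∈ (Finset.univ.filter fun x : Fin n => x ≠ o),
          (prodBernoulli w).real ({ω : BondConfig (Fin n) | s(o, x) ∈ ω} ∩
            {ω : BondConfig (Fin n) | ω \ {s(o, x)} ∈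
              {ω' : BondConfig (Fin n) | 1 ≤ (A.filter fun a => ω' ∈ openConn x a).card ∧ (A.filter fun a => ω' ∈ openConn x a).card ≤ j}}) :=
        measureReal_biUnion_finset_le _ _
    _ = ∑ x ∈ (Finset.univ.filter fun x : Fin n => x ≠ o),
          (w s(o, x) : ℝ) * (prodBernoulli (pinW w ({s(o, x)} : Set (Sym2 (Fin n))) ∅)).real
            {ω : BondConfig (Fin n) | 1 ≤ (A.filter fun a => ω ∈ openConn x a).card ∧ (A.filter fun a => ω ∈ openConn x a).card ≤ j} := by
        refine Finset.sum_congr rfl fun x _ => ?_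
        rw [real_mem_inter_preimage_diff, real_preimage_diff_eq_pinW]

/-! ### Spiders with the lightness measured in `G ∖ s(o,x)` and in `G` -/

/-- The spider hypothesis stated in `G`: every non-relay `x ≠ o` with `w(o,x) ≠ 0` starts an injective Steiner path
`p` (`p 0 = x`, all `p i ∉ A`) such that every positive-weight non-relay neighbour `v ≠ p i` of `p i` is `o` itself
when `i = 0`, or a path neighbour `p l` with `|l − i| = 1`.  Then in `G ∖ s(o,x)` the path satisfies the hypothesis
of `cil_steinerPath` verbatim. [this work] -/
theorem legs_pinW_of_legs (w : Sym2 (Fin n) → unitInterval) (A : Finset (Fin n)) (o : Fin n) {x : Fin n}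
    {k : ℕ} {p : Fin (k + 1) → Fin n} (hp0 : p 0 = x)
    (hpath : ∀ (i : Fin (k + 1)) (v : Fin n), v ∉ A → v ≠ p i → 0 < (w s(p i, v) : ℝ) →
      (v = o ∧ i = 0) ∨ ∃ l : Fin (k + 1), v = p l ∧ (l.val = i.val + 1 ∨ i.val = l.val + 1)) :
    ∀ (i : Fin (k + 1)) (v : Fin n), v ∉ A → v ≠ p i →
      0 < (pinW w ({s(o, x)} : Set (Sym2 (Fin n))) ∅ s(p i, v) : ℝ) →
      ∃ l : Fin (k + 1), v = p l ∧ (l.val = i.val + 1 ∨ i.val = l.val + 1) := by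
  intro i v hvA hvp hpos
  have hne : s(p i, v) ∉ ({s(o, x)} : Set (Sym2 (Fin n))) := by
    intro hmem
    rw [pinW_apply_of_mem_of_not_mem w hmem (Set.notMem_empty _)] at hpos
    exact lt_irrefl _ hpos
  rw [pinW_apply_of_not_mem w ∅ hne] at hpos
  rcases hpath i v hvA hvp hpos with ⟨hvo, hi0⟩ | h
  · exfalso
    apply hne
    rw [mem_singleton_iff, hvo, hi0, hp0, Sym2.eq_swap]
  · exact h

/-- **Spiders, `G ∖ e`-form.**  `o ∉ A`; spider hypothesis `hlegs` (stated in `G`, see `legs_pinW_of_legs`); if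
`0 ≤ M` dominates the relay lightnesses in every `G ∖ s(o,x)` (`μ_{pinW w {s(o,x)} ∅}(|π(a)| ≤ j) ≤ M`, `x ≠ o`,
`a ∈ A`), then `μ_w(1 ≤ N_o ≤ j) ≤ (Σ_{x ≠ o} w(o,x)) · M`, uniformly in the leg lengths. [this work] -/
theorem spider_lowerTail_le_pinW (w : Sym2 (Fin n) → unitInterval) (A : Finset (Fin n)) (o : Fin n)
    (ho : o ∉ A) (j : ℕ) (M : ℝ) (hM : 0 ≤ M)
    (hlight : ∀ x : Fin n, x ≠ o → ∀ a ∈ A, (prodBernoulli (pinW w ({s(o, x)} : Set (Sym2 (Fin n))) ∅)).real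
      {ω : BondConfig (Fin n) | (A.filter fun z => ω ∈ openConn a z).card ≤ j} ≤ M)
    (hlegs : ∀ x : Fin n, x ≠ o → x ∉ A → w s(o, x) ≠ 0 →
      ∃ (k : ℕ) (p : Fin (k + 1) → Fin n), Function.Injective p ∧ p 0 = x ∧ (∀ i, p i ∉ A) ∧
        (∀ (i : Fin (k + 1)) (v : Fin n), v ∉ A → v ≠ p i → 0 < (w s(p i, v) : ℝ) →
          (v = o ∧ i = 0) ∨ ∃ l : Fin (k + 1), v = p l ∧ (l.val = i.val + 1 ∨ i.val = l.val + 1))) :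
    (prodBernoulli w).real {ω : BondConfig (Fin n) |
        1 ≤ (A.filter fun a => ω ∈ openConn o a).card ∧ (A.filter fun a => ω ∈ openConn o a).card ≤ j} ≤
      (∑ x ∈ (Finset.univ.filter fun x : Fin n => x ≠ o), (w s(o, x) : ℝ)) * M := by
  refine (lowerTail_le_sum_firstEdge_pinW w A o ho j).trans ?_
  rw [Finset.sum_mul]
  refine Finset.sum_le_sum fun x hx => ?_
  have hxo : x ≠ o := (Finset.mem_filter.1 hx).2
  set wx := pinW w ({s(o, x)} : Set (Sym2 (Fin n))) ∅ with hwx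
  by_cases hw : w s(o, x) = 0
  · have h0 : (w s(o, x) : ℝ) = 0 := by rw [hw]; rfl
    rw [h0, zero_mul, zero_mul]
  refine mul_le_mul_of_nonneg_left ?_ (w s(o, x)).2.1
  by_cases hxA : x ∈ A
  · refine (measureReal_mono (fun ω hω => ?_) (measure_ne_top _ _)).trans (hlight x hxo x hxA)
    exact hω.2
  by_cases hA : A.Nonempty
  · obtain ⟨c, hc, hcmax⟩ := MergeStability.exists_champion (prodBernoulli wx) A hA j
    obtain ⟨k, p, hpinj, hp0, hpA, hpath⟩ := hlegs x hxo hxA hw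
    have key := cil_steinerPath A j k wx p hpinj hpA (legs_pinW_of_legs w A o hp0 hpath) c hc hcmax
    rw [hp0] at key
    exact key.trans (hlight x hxo c hc)
  · rw [Finset.not_nonempty_iff_eq_empty] at hA
    have hempty : {ω : BondConfig (Fin n) | 1 ≤ (A.filter fun a => ω ∈ openConn x a).card ∧
        (A.filter fun a => ω ∈ openConn x a).card ≤ j} = ∅ := by
      ext ω
      simp only [hA, Finset.filter_empty, Finset.card_empty, mem_setOf_eq, mem_empty_iff_false, iff_false,
        not_and, not_le]
      intro h
      exact absurd h (by norm_num)
    rw [hempty, measureReal_empty]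
    exact hM

/-- **Spiders, `G`-form lightness.**  As `spider_lowerTail_le_pinW`, with the relay lightness measured IN `G`
(`μ_w(|π(a)| ≤ j) ≤ M` on `A`) and the non-relay pairs at `o` of weight `≤ 1/2`:
`μ_w(1 ≤ N_o ≤ j) ≤ (Σ_{x ≠ o} w(o,x)) · 2M`  (closing the one pair `s(o,x)` costs the factor
`1/(1 − w(o,x)) ≤ 2`, `pinW_single_real_mul_le`). [this work] -/
theorem spider_lowerTail_le_G (w : Sym2 (Fin n) → unitInterval) (A : Finset (Fin n)) (o : Fin n)
    (ho : o ∉ A) (j : ℕ) (M : ℝ) (hM : 0 ≤ M)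
    (hhalf : ∀ x : Fin n, x ≠ o → (w s(o, x) : ℝ) ≤ 1 / 2)
    (hlightG : ∀ a ∈ A, (prodBernoulli w).real
      {ω : BondConfig (Fin n) | (A.filter fun z => ω ∈ openConn a z).card ≤ j} ≤ M)
    (hlegs : ∀ x : Fin n, x ≠ o → x ∉ A → w s(o, x) ≠ 0 →
      ∃ (k : ℕ) (p : Fin (k + 1) → Fin n), Function.Injective p ∧ p 0 = x ∧ (∀ i, p i ∉ A) ∧
        (∀ (i : Fin (k + 1)) (v : Fin n), v ∉ A → v ≠ p i → 0 < (w s(p i, v) : ℝ) →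
          (v = o ∧ i = 0) ∨ ∃ l : Fin (k + 1), v = p l ∧ (l.val = i.val + 1 ∨ i.val = l.val + 1))) :
    (prodBernoulli w).real {ω : BondConfig (Fin n) |
        1 ≤ (A.filter fun a => ω ∈ openConn o a).card ∧ (A.filter fun a => ω ∈ openConn o a).card ≤ j} ≤
      (∑ x ∈ (Finset.univ.filter fun x : Fin n => x ≠ o), (w s(o, x) : ℝ)) * (2 * M) := by
  refine spider_lowerTail_le_pinW w A o ho j (2 * M) (by positivity) (fun x hxo a ha => ?_) hlegs
  have h := pinW_single_real_mul_le w {ω : BondConfig (Fin n) | (A.filter fun z => ω ∈ openConn a z).card ≤ j} s(o, x)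
  have hw := hhalf x hxo
  have hnn : 0 ≤ (prodBernoulli (pinW w ({s(o, x)} : Set (Sym2 (Fin n))) ∅)).real
      {ω : BondConfig (Fin n) | (A.filter fun z => ω ∈ openConn a z).card ≤ j} := measureReal_nonneg
  nlinarith [hlightG a ha]

/-- **Spider small-block bound by pair counting IN `G`.**  Under the spider hypothesis and `w(o,x) ≤ 1/2` for all
pairs at `o`, if `μ_w(a ↮ a′) ≤ η` for all relays — the crux's OWN hypothesis, in `G` — then
`μ_w(1 ≤ N_o ∧ 2N_o ≤ |A|) ≤ (Σ_{x ≠ o} w(o,x)) · 8η`: `smallBlock_le_two_mul` in each `G ∖ s(o,x)`, where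
`μ_{G∖e}(a ↮ a') ≤ 2 μ_w(a ↮ a') ≤ 2η`. Linear in `t_G`, uniform in the leg lengths and `|A|`. [this work] -/
theorem spider_smallBlock_le_G (w : Sym2 (Fin n) → unitInterval) (A : Finset (Fin n)) (o : Fin n)
    (ho : o ∉ A) (η : ℝ) (hη : 0 ≤ η)
    (hhalf : ∀ x : Fin n, x ≠ o → (w s(o, x) : ℝ) ≤ 1 / 2)
    (hpair : ∀ a ∈ A, ∀ a' ∈ A, (prodBernoulli w).real (openConn a a' : Set (BondConfig (Fin n)))ᶜ ≤ η)
    (hlegs : ∀ x : Fin n, x ≠ o → x ∉ A → w s(o, x) ≠ 0 →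
      ∃ (k : ℕ) (p : Fin (k + 1) → Fin n), Function.Injective p ∧ p 0 = x ∧ (∀ i, p i ∉ A) ∧
        (∀ (i : Fin (k + 1)) (v : Fin n), v ∉ A → v ≠ p i → 0 < (w s(p i, v) : ℝ) →
          (v = o ∧ i = 0) ∨ ∃ l : Fin (k + 1), v = p l ∧ (l.val = i.val + 1 ∨ i.val = l.val + 1))) :
    (prodBernoulli w).real {ω : BondConfig (Fin n) |
        1 ≤ (A.filter fun a => ω ∈ openConn o a).card ∧ 2 * (A.filter fun a => ω ∈ openConn o a).card ≤ A.card} ≤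
      (∑ x ∈ (Finset.univ.filter fun x : Fin n => x ≠ o), (w s(o, x) : ℝ)) * (8 * η) := by
  -- `2 N ≤ |A|` iff `N ≤ |A| / 2`
  have hset : {ω : BondConfig (Fin n) | 1 ≤ (A.filter fun a => ω ∈ openConn o a).card ∧
      2 * (A.filter fun a => ω ∈ openConn o a).card ≤ A.card} =
      {ω : BondConfig (Fin n) | 1 ≤ (A.filter fun a => ω ∈ openConn o a).card ∧
      (A.filter fun a => ω ∈ openConn o a).card ≤ A.card / 2} := by
    ext ω
    simp only [mem_setOf_eq, Nat.le_div_iff_mul_le (Nat.succ_pos 1)]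
    constructor
    · rintro ⟨h1, h2⟩; exact ⟨h1, by omega⟩
    · rintro ⟨h1, h2⟩; exact ⟨h1, by omega⟩
  rw [hset]
  have h8 : (8 : ℝ) * η = 2 * (2 * (2 * η)) := by ring
  rw [h8]
  refine spider_lowerTail_le_pinW w A o ho (A.card / 2) (2 * (2 * (2 * η))) (by positivity) (fun x hxo a ha => ?_) hlegs
  set wx := pinW w ({s(o, x)} : Set (Sym2 (Fin n))) ∅ with hwx
  -- pair disconnection in `G ∖ s(o,x)` costs at most twice that in `G`
  have hpairx : ∀ a' ∈ A, (prodBernoulli wx).real (openConn a a' : Set (BondConfig (Fin n)))ᶜ ≤ 2 * (2 * η) / 2 := by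
    intro a' ha'
    have h := pinW_single_real_mul_le w (openConn a a' : Set (BondConfig (Fin n)))ᶜ s(o, x)
    have hw := hhalf x hxo
    have hnn : 0 ≤ (prodBernoulli wx).real (openConn a a' : Set (BondConfig (Fin n)))ᶜ := measureReal_nonneg
    nlinarith [hpair a ha a' ha']
  have hsb := smallBlock_le_two_mul wx A a (2 * (2 * η) / 2) ha hpairx
  refine (measureReal_mono (fun ω hω => ?_) (measure_ne_top _ _)).trans (by linarith)
  simp only [mem_setOf_eq] at hω ⊢
  rw [Nat.le_div_iff_mul_le (Nat.succ_pos 1)] at hω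
  omega

end ObserverUnionBoundG

end

end Summit.CriticalPhenomena.PercolationContinuityZ3.Theorems
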